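import Mathlib
import HarnessLib
import Summits.HubbardSuperconductivity.HubbardSuperconductivity.Theorems.KLProgrammeKLRegimeVolumeLimitLastScaleFarRows
import Summits.HubbardSuperconductivity.HubbardSuperconductivity.Theses.KLProgramme

/-!
# Route `KLProgramme` — crux K3, VL child `KLRegimeVolumeLimitV17F2` (stmt-HubbardSuperconductivity-20440): BY-`--workitem` CLOSERS for the two
# «NEAR defect + weighted rows» doors of `…VolumeLimitLastScaleFarRows` (far rows paid by token #24's tree weight)
# (cell gate-hubbard-kl, seat hubbard-kl-k3c5-p3 g11, technique «OS-positivity-free direct assembly»)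

Each closer concludes the route decl `…Theses.KLProgramme.KLRegimeVolumeLimitV17F2` BY NAME from ONE hypothesis text via
`volumeLimitTextV17F2_of_framedNestedFlowText ∘ framedNestedFlowTextV17F2_of_…`.  This file sits in the route cone by design (it imports the route
file); the doors themselves do not.  Proofs only; no definition; nothing asserts superconductivity.  References: BGM 2006 §2.4 (2.38), §2.9.
-/

noncomputable section

namespace Summit.HubbardSuperconductivity.HubbardSuperconductivity.Theorems.TwoPointAssembly

set_option linter.dupNamespace false -- summit = problem name (single-conjunct summit), D-0017

open Finset Filter Topology Complex Literature.MathematicalPhysics.QuantumLattice Literature.Probability.LatticeModels GrassmannAlgebra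
open Summit.HubbardSuperconductivity.HubbardSuperconductivity.Theorems.KLRegimeSplit
open Summit.HubbardSuperconductivity.HubbardSuperconductivity.Theorems.KLProgrammeLegKernels
open Summit.HubbardSuperconductivity.HubbardSuperconductivity.Theorems.TwoVolumeDefect

/-- **CLOSER (f)**: the VL child BY NAME from the own-frame NEAR pinned defect + the weighted fine-volume source-pair rows (door (f)).
[cite: BenfattoGiulianiMastropietro2006, §2.9 (4.3)-(4.6)] -/
theorem KLRegimeVolumeLimitV17F2_of_plainNearDefect_weightedRows
    (hD : ∀ (G : GeoConsts) (P : SplitConsts) (Q : EngConsts) (R : RenConsts), G.WF → P.WF → Q.WF → R.WF →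
      ∃ c₅ : ℝ, 0 < c₅ ∧ ∀ c : ℝ, 0 < c → c ≤ c₅ → ∃ U₀ : ℝ, 0 < U₀ ∧
        ∀ μ ∈ klWindowC, ∀ U : ℝ, 0 < U → U ≤ U₀ → ∀ β : ℝ, klBetaMin ≤ β → β ≤ Real.exp (c / U ^ 2) →
          ∀ K : TrigPolyC4v, klPredsV17F2.frameOK R U (nScales β) μ K →
            ∀ (Lstar : ℕ) (Mstar : ℕ → ℕ), TowerP klPredsV17F2 G P Q R β U μ K Lstar Mstar →
              ∃ L₀ : ℕ, ∃ δ : ℕ → ℝ, ∃ B : ℝ, Tendsto δ atTop (𝓝 0) ∧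
                ∀ (L : ℕ) [NeZero L], L₀ ≤ L → ∀ (L'' : ℕ) [NeZero L''] (b : ℕ), L'' = b * L → ∃ M₀ : ℕ, ∀ (M : ℕ) [NeZero M], M₀ ≤ M →
                  ∃ (oc : SpaceTimeIdx L M) (of : SpaceTimeIdx L'' M), of.1 = oc.1 ∧
                    2 * imagTimeWeight β M *
                      (∑ t₁ : ImagTimeIdx M, ∑ ybar : TorusSite 2 L,
                          ‖sectorisedKernel L M β (trivialMultiplier L M)
                                (klEffectiveAction L M β U μ (klFlowFrameU L M β U μ (nScales β + 1)) klE0 (nScales β + 1)) 2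
                                (![((0, 0), 0), ((0, 0), 1)] : Fin 2 → SectorLeg 1) ![oc, (t₁, oc.2 + ybar)] -
                            sectorisedKernel L'' M β (trivialMultiplier L'' M)
                                (klEffectiveAction L'' M β U μ (klFlowFrameU L'' M β U μ (nScales β + 1)) klE0 (nScales β + 1)) 2
                                (![((0, 0), 0), ((0, 0), 1)] : Fin 2 → SectorLeg 1) ![of, (t₁, of.2 + Torus.proj L'' (Torus.cRep ybar))]‖) ≤ δ L ∧
                    imagTimeWeight β M *
                      ∑ t₁ : ImagTimeIdx M, ∑ y : TorusSite 2 L'',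
                        (1 + klScale klE0 (nScales β + 1) * (Torus.tnorm y : ℝ)) *
                          ‖sectorisedKernel L'' M β (trivialMultiplier L'' M)
                              (klEffectiveAction L'' M β U μ (klFlowFrameU L'' M β U μ (nScales β + 1)) klE0 (nScales β + 1)) 2
                              (![((0, 0), 0), ((0, 0), 1)] : Fin 2 → SectorLeg 1) ![of, (t₁, of.2 + y)]‖ ≤ B) :
    Summit.HubbardSuperconductivity.HubbardSuperconductivity.Theses.KLProgramme.KLRegimeVolumeLimitV17F2 := by
  show VolumeLimitP2 klPredsV17F2 FinalTwoLegVolLimitEx klWindowC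
  exact volumeLimitTextV17F2_of_framedNestedFlowText (framedNestedFlowTextV17F2_of_plainNearDefect_weightedRows hD)

/-- **CLOSER (g)**: the VL child BY NAME from the COMMON-FRAME NEAR pinned defect + the weighted source-pair rows of both volumes (door (g)).
[cite: BenfattoGiulianiMastropietro2006, §2.9 (4.3)-(4.6)] -/
theorem KLRegimeVolumeLimitV17F2_of_commonFramePlainNearDefect_weightedRows
    (hD : ∀ (G : GeoConsts) (P : SplitConsts) (Q : EngConsts) (R : RenConsts), G.WF → P.WF → Q.WF → R.WF →
      ∃ c₅ : ℝ, 0 < c₅ ∧ ∀ c : ℝ, 0 < c → c ≤ c₅ → ∃ U₀ : ℝ, 0 < U₀ ∧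
        ∀ μ ∈ klWindowC, ∀ U : ℝ, 0 < U → U ≤ U₀ → ∀ β : ℝ, klBetaMin ≤ β → β ≤ Real.exp (c / U ^ 2) →
          ∀ K : TrigPolyC4v, klPredsV17F2.frameOK R U (nScales β) μ K →
            ∀ (Lstar : ℕ) (Mstar : ℕ → ℕ), TowerP klPredsV17F2 G P Q R β U μ K Lstar Mstar →
              ∃ L₀ : ℕ, ∃ δ : ℕ → ℝ, ∃ B : ℝ, Tendsto δ atTop (𝓝 0) ∧
                ∀ (L : ℕ) [NeZero L], L₀ ≤ L → ∀ (L'' : ℕ) [NeZero L''] (b : ℕ), L'' = b * L → ∃ M₀ : ℕ, ∀ (M : ℕ) [NeZero M], M₀ ≤ M →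
                  ∃ (oc : SpaceTimeIdx L M) (of : SpaceTimeIdx L'' M), of.1 = oc.1 ∧
                    2 * imagTimeWeight β M *
                      (∑ t₁ : ImagTimeIdx M, ∑ ybar : TorusSite 2 L,
                          ‖sectorisedKernel L M β (trivialMultiplier L M)
                                (klEffectiveAction L M β U μ (klFlowFrameU L M β U μ (nScales β + 1)) klE0 (nScales β + 1)) 2
                                (![((0, 0), 0), ((0, 0), 1)] : Fin 2 → SectorLeg 1) ![oc, (t₁, oc.2 + ybar)] -
                            sectorisedKernel L'' M β (trivialMultiplier L'' M)
                                (klEffectiveAction L'' M β U μ (klFlowFrameU L M β U μ (nScales β + 1)) klE0 (nScales β + 1)) 2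
                                (![((0, 0), 0), ((0, 0), 1)] : Fin 2 → SectorLeg 1) ![of, (t₁, of.2 + Torus.proj L'' (Torus.cRep ybar))]‖) ≤ δ L ∧
                    imagTimeWeight β M *
                      ∑ t₁ : ImagTimeIdx M, ∑ y : TorusSite 2 L'',
                        (1 + klScale klE0 (nScales β + 1) * (Torus.tnorm y : ℝ)) *
                          ‖sectorisedKernel L'' M β (trivialMultiplier L'' M)
                              (klEffectiveAction L'' M β U μ (klFlowFrameU L M β U μ (nScales β + 1)) klE0 (nScales β + 1)) 2
                              (![((0, 0), 0), ((0, 0), 1)] : Fin 2 → SectorLeg 1) ![of, (t₁, of.2 + y)]‖ ≤ B ∧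
                    imagTimeWeight β M *
                      ∑ t₁ : ImagTimeIdx M, ∑ y : TorusSite 2 L,
                        (1 + klScale klE0 (nScales β + 1) * (Torus.tnorm y : ℝ)) *
                          ‖sectorisedKernel L M β (trivialMultiplier L M)
                              (klEffectiveAction L M β U μ (klFlowFrameU L M β U μ (nScales β + 1)) klE0 (nScales β + 1)) 2
                              (![((0, 0), 0), ((0, 0), 1)] : Fin 2 → SectorLeg 1) ![oc, (t₁, oc.2 + y)]‖ ≤ B) :
    Summit.HubbardSuperconductivity.HubbardSuperconductivity.Theses.KLProgramme.KLRegimeVolumeLimitV17F2 := by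
  show VolumeLimitP2 klPredsV17F2 FinalTwoLegVolLimitEx klWindowC
  exact volumeLimitTextV17F2_of_framedNestedFlowText (framedNestedFlowTextV17F2_of_commonFramePlainNearDefect_weightedRows hD)

end Summit.HubbardSuperconductivity.HubbardSuperconductivity.Theorems.TwoPointAssembly

end
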